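import Summits.Ventures.HodgeRepro2.T5UnimodularWeights
import Summits.Ventures.HodgeRepro2.T5CharacterTheory

/-!
# Orthogonality of weights: `∫ χ_W · conj χ_{W'} dμ = [χ_W = χ_{W'}]`

Blind cell `pub-hodge-repro2`, seat p1 (gen 12), Tier-5 kernel support for the S4.7 row «the weights
of SO(2) are orthogonal» (P2′) in its general form: `T5TorusCharacters` proved
`∫₀^{2π} e^{imθ} · conj e^{inθ} dθ = 2π·[m = n]` for the circle by direct computation; here the same
statement is derived for the weights of ANY continuous representation of a compact group from the
orthonormality of irreducible characters (`T5CharacterTheory.integral_character_mul_conj_eq_ite`).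

* `restrictRep_eq_weight_smul_one` — on a stable line, `π|W g = weight g • 1`;
* `character_restrictRep_eq_weight` — the character of a stable line IS its weight;
* `isIrreducibleSubspace_of_finrank_eq_one` — a stable line is an irreducible stable subspace;
* `weight_eq_of_equiv` — equivalent lines have equal weights;
* **`integral_weight_mul_conj_weight`** — for two stable lines `W`, `W'` (spanned by `w`, `w'`) of a
  continuous representation of a compact group,
  `∫ weight_W g · conj (weight_{W'} g) dμ = if weight_W = weight_{W'} then 1 else 0`
  (equal weights: the integrand is `|χ|² = 1`; different weights: the lines are inequivalent
  irreducibles, so their characters are orthogonal).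

Honest scope (unchanged): compact groups, finite-dimensional representations; the weights {3, 5, 7, …}
of the infinite-dimensional π₃⁺ are not an instance ([C]).
-/

namespace Summit.Ventures.HodgeRepro2.T5WeightOrthogonality

open MeasureTheory T5SchurOrthogonality T5CompleteReducibility T5RestrictionRep T5SchurMathlib
  T5AbelianWeights T5UnimodularWeights

variable {G : Type*} [Group G]
variable {V : Type*} [NormedAddCommGroup V] [InnerProductSpace ℂ V]
variable (π : G →* V →L[ℂ] V)

section line

variable {W : Submodule ℂ V} (hW : IsStable π W) (h1 : Module.finrank ℂ W = 1)
variable {w : V} (hw : w ∈ W) (hw0 : w ≠ 0)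

include h1 hw hw0 in
/-- Every element of a stable line spanned by `w` is a multiple of `w`. -/
theorem exists_eq_smul (x : W) : ∃ c : ℂ, x = c • (⟨w, hw⟩ : W) := by
  have hne : (⟨w, hw⟩ : W) ≠ 0 := fun h => hw0 (congrArg Subtype.val h)
  obtain ⟨c, hc⟩ := (finrank_eq_one_iff_of_nonzero' (⟨w, hw⟩ : W) hne).mp h1 x
  exact ⟨c, hc.symm⟩

/-- On a stable line, the restricted representation acts by the weight: `π|W g = weight g • 1`. -/
theorem restrictRep_eq_weight_smul_one (g : G) :
    restrictRep π W hW g = weight π hW h1 hw hw0 g • (1 : W →L[ℂ] W) := by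
  ext x
  obtain ⟨c, rfl⟩ := exists_eq_smul h1 hw hw0 x
  rw [smul_apply, one_apply_eq_self]
  simp only [coe_restrictRep_apply, Submodule.coe_smul, map_smul, weight_spec π hW h1 hw hw0 g,
    smul_smul, mul_comm]

/-- The character of a stable line is its weight. -/
theorem character_restrictRep_eq_weight (g : G) :
    character (restrictRep π W hW) g = weight π hW h1 hw hw0 g := by
  haveI : FiniteDimensional ℂ W := Module.finite_of_finrank_pos (by omega)
  unfold character
  rw [restrictRep_eq_weight_smul_one π hW h1 hw hw0 g, ContinuousLinearMap.toLinearMap_smul,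
    ContinuousLinearMap.toLinearMap_one, map_smul, LinearMap.trace_one, h1]
  simp

end line

section two_lines

variable {W : Submodule ℂ V} (hW : IsStable π W) (h1 : Module.finrank ℂ W = 1)
variable {w : V} (hw : w ∈ W) (hw0 : w ≠ 0)
variable {W' : Submodule ℂ V} (hW' : IsStable π W') (h1' : Module.finrank ℂ W' = 1)
variable {w' : V} (hw' : w' ∈ W') (hw0' : w' ≠ 0)

variable [FiniteDimensional ℂ V]

include hW h1 in
/-- A stable line is an irreducible stable subspace (its stable subspaces are `⊥` or itself). -/
theorem isIrreducibleSubspace_of_finrank_eq_one : IsIrreducibleSubspace π W := by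
  refine ⟨?_, hW, fun U hU _ => ?_⟩
  · intro hbot
    rw [hbot, finrank_bot] at h1
    exact zero_ne_one h1
  · have hle : Module.finrank ℂ U ≤ 1 := h1 ▸ Submodule.finrank_mono hU
    rcases Nat.le_one_iff_eq_zero_or_eq_one.mp hle with h0 | hone
    · exact Or.inl (Submodule.finrank_eq_zero.mp h0)
    · exact Or.inr (Submodule.eq_of_le_of_finrank_eq hU (hone.trans h1.symm))

/-- Equivalent stable lines have the same weight (equal characters). -/
theorem weight_eq_of_equiv
    (e : (toRep (restrictRep π W' hW')).Equiv (toRep (restrictRep π W hW))) :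
    weight π hW h1 hw hw0 = weight π hW' h1' hw' hw0' := by
  funext g
  rw [← character_restrictRep_eq_weight π hW h1 hw hw0 g,
    ← character_restrictRep_eq_weight π hW' h1' hw' hw0' g]
  exact T5Multiplicity.character_eq_of_equiv _ _ e g

variable [TopologicalSpace G] [IsTopologicalGroup G] [MeasurableSpace G] [BorelSpace G]
  [CompactSpace G]
variable (μ : Measure G) [IsProbabilityMeasure μ] [μ.IsOpenPosMeasure] [μ.IsMulLeftInvariant]

open Classical in
/-- **Orthogonality of weights**: for two stable lines of a continuous representation of a compact
group, `∫ weight_W g · conj (weight_{W'} g) dμ = 1` if the weights coincide and `0` otherwise. -/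
theorem integral_weight_mul_conj_weight (hπ : Continuous π) :
    ∫ g, weight π hW h1 hw hw0 g * (starRingEnd ℂ) (weight π hW' h1' hw' hw0' g) ∂μ =
      if weight π hW h1 hw hw0 = weight π hW' h1' hw' hw0' then 1 else 0 := by
  split_ifs with heq
  · -- equal weights: the integrand is `|χ|² = 1`
    have hone : ∀ g, weight π hW h1 hw hw0 g * (starRingEnd ℂ) (weight π hW' h1' hw' hw0' g) = 1 := by
      intro g
      rw [← heq, Complex.mul_conj', norm_weight_eq_one μ π hπ hW h1 hw hw0 g]
      simp
    simp only [hone, integral_const, probReal_univ, one_smul]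
  · -- different weights: inequivalent irreducible lines, orthogonal characters
    haveI : Nontrivial W := nontrivial_of_isIrreducibleSubspace π W
      (isIrreducibleSubspace_of_finrank_eq_one π hW h1)
    haveI : Nontrivial W' := nontrivial_of_isIrreducibleSubspace π W'
      (isIrreducibleSubspace_of_finrank_eq_one π hW' h1')
    have hchar := T5CharacterTheory.integral_character_mul_conj_eq_ite μ (restrictRep π W hW)
      (restrictRep π W' hW') (T5Multiplicity.continuous_restrictRep π hπ W hW)
      (T5Multiplicity.continuous_restrictRep π hπ W' hW')
      (isIrreducible_restrictRep π W (isIrreducibleSubspace_of_finrank_eq_one π hW h1) hW)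
      (isIrreducible_restrictRep π W' (isIrreducibleSubspace_of_finrank_eq_one π hW' h1') hW')
    have hne : ¬ Nonempty ((toRep (restrictRep π W' hW')).Equiv (toRep (restrictRep π W hW))) :=
      fun ⟨e⟩ => heq (weight_eq_of_equiv π hW h1 hw hw0 hW' h1' hw' hw0' e)
    rw [if_neg hne] at hchar
    rw [← hchar]
    congr 1
    funext g
    rw [character_restrictRep_eq_weight π hW h1 hw hw0 g,
      character_restrictRep_eq_weight π hW' h1' hw' hw0' g]

end two_lines

end Summit.Ventures.HodgeRepro2.T5WeightOrthogonality
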